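import Mathlib

/-!
# Target `stub_fractional` of line `drc-selfrich-core` (crux `RegularResolutionRung`, stmt-PneNP-9818) is FALSE
# modulo a standard host graph

cdisprove seat `refuter-cdisprove-stmt-PneNP-9818-g3-0`, cycle 2 (2026-08-16). While this file was
being checked the line's planner (generation 2, commit c91e2a1eec3f) found the same design on paper
(line card §F1) and RESTATED the stub in spread-cover form (FRAC₂); this file is the machine-checked
record that generation 1's FRAC v1 is dead, and of the exact window of the witness (see the end of
this docstring). FRAC₂ is NOT refuted by it (the traps below admit the cover `𝓒 =` the traps
themselves, of cost `(|U_i|θ)^{r+1} ≤ (Mθ)^{r+1}`, within FRAC₂'s relative demand).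

`StubFractional` below is the statement of `stub_fractional` in
`Cruxes/RegularResolutionRung/Lines/drc-selfrich-core.lean` VERBATIM (the skeleton is not an importable
module). It asserts, for every self-rich (SR) and two-sided bi-dense (BD, at scale `|S|^{1-β}`) set `S`,
the FRACTIONAL MOSTLY-DENSENESS property FRAC: for every `(r,q)`-dense `W ⊆ S` and all admissible
`T, r, cap, q', θ`, the spread weight of the inclusion-minimal traps satisfies `(Σ_B θ^{|B|})^4 ≤ θ^r`.

## The kill (sub-radar planted holes ⇒ exponentially many transversal traps)
BD only speaks about pairs of sets BOTH of size `≥ |S|^{1-β}`, while FRAC must hold down to the trap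
threshold `q' = |S|^{1-β}` and up to the coin bias `θ = (log₂ n)²/q'`. Plant, inside an otherwise
random-like `S`, `r+1` groups `U₀,…,U_r` of `|S|^{1-β}/8` vertices each (below the BD radar) and a
set `W = C₀ ⊔ … ⊔ C_r ⊆ S` of `r+1` large classes, and delete every edge between `U_i` and `C_i`.
Then SR and BD are untouched (holes cost `< |A||B|/4` ordered pairs between sets of size `≥ |S|^{1-β}`),
`W` is `(r,q)`-dense with `q = 2·4^{r+1}|S|^{1-β}` (an `r`-set misses one class, where it has
`≈ |C| 2^{-r}` common neighbours), every TRANSVERSAL `{u₀,…,u_r}` (`u_i ∈ U_i`) is a trap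
(`N̂_W = ∅`), and it is inclusion-MINIMAL (dropping `u_i` frees the class `C_i`, which holds `≥ q'`
common neighbours of the rest). With `T = ∅`, `cap = r+1`, `q' = |S|^{1-β}`, `δ = 1/4`
(`q' = δ^{cap} q/2` exactly) and `θ = (log₂ n)²/q'` the trap weight is at least
`∏_i (|U_i| θ) ≥ ((log₂ n)²/8)^{r+1} ≥ 1 > θ^r` — FRAC fails. Constants used:
`(c, γ, β, δ, γ', C₁) = (1/16, 1/8, 1/4, 1/4, 1/2, 80)`, `n = 2^{80 r}` (so `r = log₂ n / C₁`,
`cap + r = 2r+1 ≤ 5r = c·log₂ n`).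

## What is proved here, and modulo what
* `false_of_transversal_traps` — the pure counting core: if a family `F` of vertex sets contains the
  image of every transversal of pairwise disjoint groups `U_i` with `|U_i|·θ ≥ 2`, `0 < θ < 1`, then
  `(Σ_{B ∈ F} θ^{|B|})^4 ≤ θ^r` is impossible (`r ≥ 1`).
* `stubFractional_false_of_host : FracHost → ¬ StubFractional` — the host hypothesis `FracHost` is
  the existence, for infinitely many `r`, of a graph on `2^{80r}` vertices with a set `S` that is SR
  and BD VERBATIM as in the stub, plus the planted structure (classes `C_i` covering `W`, groups
  `U_i ⊆ S ∖ W` pairwise disjoint with `8|U_i| ≥ |S|^{3/4}`, no `U_i`–`C_i` edges) and the two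
  richness facts (`N̂_W(R) ≥ 2·4^{r+1}|S|^{3/4}` for `|R| ≤ r`; `N̂_{C_i}(R) ≥ |S|^{3/4}` for `|R| ≤ r`
  avoiding `U_i`). `FracHost` holds for `G(n,½)` with the holes deleted (`|C_i| = 16·8^r·n^{3/4}`,
  `|U_i| = n^{3/4}/8`, Chernoff + union bounds; the hole correction to `e(A,B)` is `≤ |A||B|/4`
  ordered pairs when `|A|,|B| ≥ n^{3/4}`, against a slack of `|A||B|/8`), and — expected, with
  ELEMENTARY proofs, the natural derandomisation — for the quadratic Cayley graph
  `x ~ y ⇔ Q(x ⊕ y) = 1` on `𝔽₂^{80r}` (`Q` hyperbolic) restricted to `S = {Q = 0, x₁ = 1}` with affine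
  classes: SR by the bias `≤ 1/2` of non-affine quadratics on subspaces of dimension `> 40r`, BD by
  the character-sum Cauchy–Schwarz `|Σ_{a∈A,b∈B} (-1)^{Q(a+b)}| ≤ √(2^{80r}|A||B|)`. Neither host is
  constructed in the tree yet, hence the implication form (a NEGATIVE LEMMA modulo `FracHost`; the
  crux item itself is NOT refuted by this file).

## Consequence for the line
`stub_fractional` as filed cannot be proved. The witness does not touch the line's transfer
"self-rich + bi-dense core ⇒ regular hardness" (the planted host contains `G(m,½)`-like induced
subgraphs on `m/2` vertices, so `Clique` IS hard for regular resolution there by ABdRLNR21 Thm 5.1);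
it kills the chosen FORMALISATION of property 2: with `W` universally quantified and the trap
threshold `q'` allowed down to the BD scale `|S|^{1-β}`, sub-radar bicliques of side `< |S|^{1-β}`
mass-produce minimal traps. Repairs a planner may try (each stated so the witness can be re-run):
(i) raise the trap threshold, `q' ≥ |S|^{1-β+η}`: the same witness still bites for every
`η < (1-β)/(3 + 4/r)` (weight `(|S|^{-η}(log₂ n)²)^{r+1}` vs `θ^{r/4}`), so one needs
`η > (1-β)/3`, i.e. BD at a scale polynomially BELOW the trap threshold, and then `stub_bottleneck`'s
instance (`q' = δ^{⌈k/t⌉} q/2`) needs `β - γ - (2/t)log₂(1/δ) > (1-β)/3`; (ii) restrict `W` to the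
sets the bottleneck argument actually produces (common neighbourhoods of `≤ k` vertices inside
blocks) instead of all `W ⊆ S` — this does not obviously help: the classes can themselves be
planted as such neighbourhoods (`C_i := N̂_S(z_i) ∩ block`); (iii) forbid sub-radar bicliques
outright (no `K̄_{a,b}` in the bipartite complement with `a ≥ |S|^{μ}`, `b ≥ |S|^{1-β}`) — the same
knob as (i) (it separates the BD scale from the trap threshold) and a genuinely stronger
pseudo-randomness demand on `stub_core` (Ramsey-ness tolerates planting such holes in `G(n,½)`,
cf. Disproof.lean (d)/(e), so a Ramsey core need not satisfy it unless the core is re-selected).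
-/

namespace Summit.PneNP.PneNP.Theorems.RegularResolutionRung.Negative

/-- `stub_fractional` of `Lines/drc-selfrich-core.lean`, verbatim (FRAC for self-rich bi-dense cores). -/
def StubFractional : Prop :=
    ∀ c γ β δ γ' C₁ : ℝ, 0 < c → 0 < γ → γ < β → β < 1 → 0 < δ → δ < 1 / 2 → 0 < γ' → 0 < C₁ →
    ∃ n₀ : ℕ, ∀ n ≥ n₀, ∀ (G : SimpleGraph (Fin n)) [DecidableRel G.Adj] (S : Finset (Fin n)),
      (n : ℝ) ^ γ' ≤ S.card →
      (∀ R ⊆ S, (R.card : ℝ) ≤ c * Real.logb 2 n →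
        (S.card : ℝ) ^ (1 - γ) ≤ ((S.filter fun v => ∀ u ∈ R, G.Adj u v).card : ℝ)) →
      (∀ A ⊆ S, ∀ B ⊆ S, (S.card : ℝ) ^ (1 - β) ≤ A.card → (S.card : ℝ) ^ (1 - β) ≤ B.card →
        δ * A.card * B.card ≤ (((A ×ˢ B).filter fun p => G.Adj p.1 p.2).card : ℝ) ∧
          (((A ×ˢ B).filter fun p => G.Adj p.1 p.2).card : ℝ) ≤ (1 - δ) * A.card * B.card) →
      (∀ (W T : Finset (Fin n)) (r cap : ℕ) (q q' θ : ℝ),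
        W ⊆ S → T ⊆ S → Disjoint W T → G.IsClique (↑T : Set (Fin n)) → 2 * T.card ≤ r →
        Real.logb 2 n ≤ C₁ * r → ((cap + r : ℕ) : ℝ) ≤ c * Real.logb 2 n → (cap : ℝ) * min c 1 ≤ 3 * r →
        (S.card : ℝ) ^ (1 - β) ≤ q' → q' ≤ δ ^ cap * q / 2 → 0 < θ → θ * q' ≤ Real.logb 2 n ^ 2 →
        (∀ R ⊆ S, R.card ≤ r → q ≤ ((W.filter fun v => ∀ u ∈ R, G.Adj u v).card : ℝ)) →
        (Finset.sum
            (S.powerset.filter fun B => B.card ≤ cap ∧ Disjoint T B ∧ Disjoint W B ∧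
              ((W.filter fun v => ∀ u ∈ T ∪ B, G.Adj u v).card : ℝ) < q' ∧
              ∀ B' ∈ B.ssubsets, q' ≤ ((W.filter fun v => ∀ u ∈ T ∪ B', G.Adj u v).card : ℝ))
            fun B => θ ^ B.card) ^ 4 ≤ θ ^ r)

/-- HOST HYPOTHESIS (not yet constructed in the tree; true for `G(n,½)` with `r+1` planted
sub-radar holes, and for the quadratic Cayley graph over `𝔽₂^{80r}` with planted holes — see the
module docstring). For infinitely many `r`, on `n = 2^{80r}` vertices: a set `S` (`|S| ≥ n^{1/2}`)
that is self-rich with `(c,γ) = (1/16, 1/8)` and bi-dense with `(β,δ) = (1/4, 1/4)` EXACTLY as the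
stub demands, a set `W ⊆ S` covered by classes `C₀,…,C_r`, pairwise disjoint groups `U₀,…,U_r ⊆ S∖W`
with `8|U_i| ≥ |S|^{3/4}`, no edges between `U_i` and `C_i`, every `≤ r`-subset of `S` has
`≥ 2·4^{r+1}|S|^{3/4}` common neighbours in `W`, and every `≤ r`-subset of `S` avoiding `U_i` has
`≥ |S|^{3/4}` common neighbours in `C_i`. -/
def FracHost : Prop :=
  ∀ n₀ : ℕ, ∃ r : ℕ, n₀ ≤ r ∧
    ∃ (G : SimpleGraph (Fin (2 ^ (80 * r)))) (_ : DecidableRel G.Adj)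
      (S W : Finset (Fin (2 ^ (80 * r)))) (C U : Fin (r + 1) → Finset (Fin (2 ^ (80 * r)))),
      ((2 ^ (80 * r) : ℕ) : ℝ) ^ (1 / 2 : ℝ) ≤ S.card ∧
      (∀ R ⊆ S, (R.card : ℝ) ≤ 1 / 16 * Real.logb 2 ((2 ^ (80 * r) : ℕ) : ℝ) →
        (S.card : ℝ) ^ (1 - 1 / 8 : ℝ) ≤ ((S.filter fun v => ∀ u ∈ R, G.Adj u v).card : ℝ)) ∧
      (∀ A ⊆ S, ∀ B ⊆ S, (S.card : ℝ) ^ (1 - 1 / 4 : ℝ) ≤ A.card → (S.card : ℝ) ^ (1 - 1 / 4 : ℝ) ≤ B.card →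
        1 / 4 * A.card * B.card ≤ (((A ×ˢ B).filter fun p => G.Adj p.1 p.2).card : ℝ) ∧
          (((A ×ˢ B).filter fun p => G.Adj p.1 p.2).card : ℝ) ≤ (1 - 1 / 4) * A.card * B.card) ∧
      W ⊆ S ∧ (∀ i, C i ⊆ W) ∧ (∀ w ∈ W, ∃ i, w ∈ C i) ∧
      (∀ i, U i ⊆ S) ∧ (∀ i, Disjoint (U i) W) ∧ (∀ i j, i ≠ j → Disjoint (U i) (U j)) ∧
      (∀ i, (S.card : ℝ) ^ (1 - 1 / 4 : ℝ) ≤ 8 * (U i).card) ∧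
      (∀ i, ∀ u ∈ U i, ∀ w ∈ C i, ¬ G.Adj u w) ∧
      (∀ R ⊆ S, R.card ≤ r →
        2 * 4 ^ (r + 1) * (S.card : ℝ) ^ (1 - 1 / 4 : ℝ) ≤ ((W.filter fun v => ∀ u ∈ R, G.Adj u v).card : ℝ)) ∧
      (∀ i, ∀ R ⊆ S, R.card ≤ r → Disjoint R (U i) →
        (S.card : ℝ) ^ (1 - 1 / 4 : ℝ) ≤ (((C i).filter fun v => ∀ u ∈ R, G.Adj u v).card : ℝ))

/-- **Counting core.** If `F` contains the image of every transversal of pairwise disjoint groups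
`U i` (`i : ι`), each with `|U i|·θ ≥ 2`, and `0 < θ < 1`, then `(Σ_{B∈F} θ^{|B|})^4 ≤ θ^r` fails
for `r ≥ 1`: the transversal images are distinct sets of size `|ι|`, so the sum is at least
`∏_i (|U i| θ) ≥ 1 > θ^r`. -/
theorem false_of_transversal_traps {V ι : Type*} [DecidableEq V] [Fintype ι] [DecidableEq ι]
    {F : Finset (Finset V)} {θ : ℝ} {r : ℕ} (U : ι → Finset V)
    (key : (F.sum fun B => θ ^ B.card) ^ 4 ≤ θ ^ r)
    (hθ0 : 0 < θ) (hθ1 : θ < 1) (hr : 1 ≤ r)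
    (hdisj : ∀ i j, i ≠ j → Disjoint (U i) (U j))
    (hbig : ∀ i, 2 ≤ (U i).card * θ)
    (hmem : ∀ f : ι → V, (∀ i, f i ∈ U i) → Finset.univ.image f ∈ F) : False := by
  -- transversals and their images
  set Tr : Finset (ι → V) := Fintype.piFinset U with hTr
  have hTr_mem : ∀ f ∈ Tr, ∀ i, f i ∈ U i := fun f hf => Fintype.mem_piFinset.1 hf
  have hinj_f : ∀ f ∈ Tr, Function.Injective f := by
    intro f hf i j hij
    by_contra hne
    have h1 : f i ∈ U i := hTr_mem f hf i
    have h2 : f i ∈ U j := hij ▸ hTr_mem f hf j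
    exact Finset.disjoint_left.1 (hdisj i j hne) h1 h2
  have hcard_img : ∀ f ∈ Tr, (Finset.univ.image f).card = Fintype.card ι := fun f hf => by
    rw [Finset.card_image_of_injective _ (hinj_f f hf), Finset.card_univ]
  have hinjOn : Set.InjOn (fun f : ι → V => Finset.univ.image f) ↑Tr := by
    intro f hf g hg hfg
    funext i
    have hfi : f i ∈ Finset.univ.image g := by
      have : f i ∈ Finset.univ.image f := Finset.mem_image_of_mem f (Finset.mem_univ i)
      simpa [hfg] using this
    obtain ⟨j, -, hj⟩ := Finset.mem_image.1 hfi
    by_cases hji : j = i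
    · subst hji; exact hj.symm
    · exact absurd (hj ▸ hTr_mem g hg j) (Finset.disjoint_left.1 (hdisj i j (Ne.symm hji)) (hTr_mem f hf i))
  -- the sum over F dominates the sum over transversal images
  have hsub : Tr.image (fun f : ι → V => Finset.univ.image f) ⊆ F := by
    intro B hB
    obtain ⟨f, hf, rfl⟩ := Finset.mem_image.1 hB
    exact hmem f (hTr_mem f hf)
  have hsum : (Tr.card : ℝ) * θ ^ Fintype.card ι ≤ F.sum fun B => θ ^ B.card := by
    calc (Tr.card : ℝ) * θ ^ Fintype.card ι
        = Tr.sum (fun f => θ ^ (Finset.univ.image f).card) := by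
          rw [Finset.sum_congr rfl (fun f hf => by rw [hcard_img f hf]), Finset.sum_const, nsmul_eq_mul]
      _ = (Tr.image (fun f : ι → V => Finset.univ.image f)).sum (fun B => θ ^ B.card) :=
          (Finset.sum_image (f := fun B : Finset V => θ ^ B.card) hinjOn).symm
      _ ≤ F.sum fun B => θ ^ B.card :=
          Finset.sum_le_sum_of_subset_of_nonneg hsub (fun B _ _ => pow_nonneg hθ0.le _)
  -- the transversal weight is ∏ (|U i| θ) ≥ 1
  have hprod : (1 : ℝ) ≤ (Tr.card : ℝ) * θ ^ Fintype.card ι := by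
    have hTrcard : (Tr.card : ℝ) = Finset.univ.prod fun i => ((U i).card : ℝ) := by
      rw [hTr, Fintype.card_piFinset]; push_cast; rfl
    rw [hTrcard, ← Finset.card_univ, ← Finset.prod_const, ← Finset.prod_mul_distrib]
    calc (1 : ℝ) = Finset.univ.prod (fun _ : ι => (1 : ℝ)) := Finset.prod_const_one.symm
      _ ≤ Finset.univ.prod (fun i => ((U i).card : ℝ) * θ) :=
          Finset.prod_le_prod (fun _ _ => zero_le_one) (fun i _ => by linarith [hbig i])
  have h1 : (1 : ℝ) ≤ F.sum fun B => θ ^ B.card := hprod.trans hsum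
  have h4 : (1 : ℝ) ≤ (F.sum fun B => θ ^ B.card) ^ 4 := one_le_pow₀ h1
  have hθr : θ ^ r < 1 := pow_lt_one₀ hθ0.le hθ1 (by omega)
  linarith

/-- **`stub_fractional` is false modulo the host.** Instantiate the stub at
`(c, γ, β, δ, γ', C₁) = (1/16, 1/8, 1/4, 1/4, 1/2, 80)`, take the host at `n = 2^{80r} ≥ n₀`, and
apply FRAC to `W`, `T = ∅`, `r`, `cap = r+1`, `q = 2·4^{r+1}|S|^{3/4}`, `q' = |S|^{3/4}`,
`θ = (log₂ n)²/q' = (80r)²/q'`: every side condition holds (with equality in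
`q' ≤ δ^{cap} q/2` and `θ q' ≤ (log₂ n)²`), every transversal of the groups is an inclusion-minimal
trap, and `false_of_transversal_traps` finishes (`|U_i| θ ≥ (80 r)²/8 ≥ 2`, `θ < 1` because
`(80r)² < 2^{30r} ≤ n^{3/8} ≤ |S|^{3/4}`). -/
theorem stubFractional_false_of_host (hH : FracHost) : ¬ StubFractional := by
  intro hSF
  obtain ⟨n₀, hn₀⟩ := hSF (1 / 16) (1 / 8) (1 / 4) (1 / 4) (1 / 2) 80 (by norm_num) (by norm_num)
    (by norm_num) (by norm_num) (by norm_num) (by norm_num) (by norm_num) (by norm_num)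
  obtain ⟨r, hr, G, hdec, S, W, C, U, hS, hSR, hBD, hWS, hCW, hcov, hUS, hUW, hUU, hUcard, hhole,
    hrich, hrich1⟩ := hH (max n₀ 1)
  have hr1 : 1 ≤ r := le_trans (le_max_right _ _) hr
  have hrn₀ : n₀ ≤ r := le_trans (le_max_left _ _) hr
  -- the parameters (`n = 2^{80 r}` is kept literal: `G`, `S`, … depend on it)
  have hrn : r ≤ 2 ^ (80 * r) :=
    (Nat.lt_two_pow_self).le.trans (Nat.pow_le_pow_right (by norm_num) (by omega))
  have hn₀n : 2 ^ (80 * r) ≥ n₀ := hrn₀.trans hrn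
  have hnR : ((2 ^ (80 * r) : ℕ) : ℝ) = (2 : ℝ) ^ (80 * r) := by push_cast; ring
  have hlog : Real.logb 2 ((2 ^ (80 * r) : ℕ) : ℝ) = 80 * r := by
    rw [hnR, Real.logb_pow, Real.logb_self_eq_one (by norm_num : (1 : ℝ) < 2)]; push_cast; ring
  have hn1 : (1 : ℝ) ≤ ((2 ^ (80 * r) : ℕ) : ℝ) := by exact_mod_cast Nat.one_le_two_pow
  have hn12 : (1 : ℝ) ≤ ((2 ^ (80 * r) : ℕ) : ℝ) ^ (1 / 2 : ℝ) := Real.one_le_rpow hn1 (by norm_num)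
  have hScard : (1 : ℝ) ≤ S.card := hn12.trans hS
  set q' : ℝ := (S.card : ℝ) ^ (1 - 1 / 4 : ℝ) with hq'
  have hq'pos : 0 < q' := Real.rpow_pos_of_pos (by linarith) _
  set θ : ℝ := Real.logb 2 ((2 ^ (80 * r) : ℕ) : ℝ) ^ 2 / q' with hθ
  have hrR : (1 : ℝ) ≤ r := by exact_mod_cast hr1
  have hlogpos : 0 < Real.logb 2 ((2 ^ (80 * r) : ℕ) : ℝ) := by rw [hlog]; linarith
  have hθpos : 0 < θ := div_pos (pow_pos hlogpos 2) hq'pos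
  -- θ < 1 :  (80 r)² < 2^{30 r} ≤ n^{3/8} ≤ |S|^{3/4} = q'
  have hθlt : θ < 1 := by
    rw [hθ, div_lt_one hq'pos, hlog]
    have hnat : (80 * r) ^ 2 < 2 ^ (30 * r) := by
      have hr2 : r < 2 ^ r := Nat.lt_two_pow_self
      have hA : r * r < 2 ^ r * 2 ^ r := Nat.mul_lt_mul'' hr2 hr2
      calc (80 * r) ^ 2 = 6400 * (r * r) := by ring
        _ < 6400 * (2 ^ r * 2 ^ r) := (Nat.mul_lt_mul_left (by norm_num)).2 hA
        _ ≤ 2 ^ 13 * (2 ^ r * 2 ^ r) := Nat.mul_le_mul_right _ (by norm_num)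
        _ = 2 ^ (13 + 2 * r) := by rw [pow_add, two_mul, pow_add]
        _ ≤ 2 ^ (30 * r) := Nat.pow_le_pow_right (by norm_num) (by omega)
    have h1 : ((80 * r : ℕ) : ℝ) ^ 2 < (2 : ℝ) ^ (30 * r) := by exact_mod_cast hnat
    have h2 : (2 : ℝ) ^ (30 * r) ≤ q' := by
      have h3 : (((2 ^ (80 * r) : ℕ) : ℝ) ^ (1 / 2 : ℝ)) ^ (1 - 1 / 4 : ℝ) ≤ q' :=
        Real.rpow_le_rpow (by positivity) hS (by norm_num)
      rw [← Real.rpow_mul (by positivity), hnR] at h3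
      have h4 : ((2 : ℝ) ^ (80 * r)) ^ ((1 / 2 : ℝ) * (1 - 1 / 4)) = (2 : ℝ) ^ (30 * r) := by
        rw [← Real.rpow_natCast, ← Real.rpow_natCast, ← Real.rpow_mul (by norm_num)]
        congr 1; push_cast; ring
      rw [h4] at h3
      exact h3
    have h5 : ((80 : ℝ) * r) ^ 2 = ((80 * r : ℕ) : ℝ) ^ 2 := by push_cast; ring
    rw [h5]
    exact h1.trans_le h2
  -- the factor bound |U i| θ ≥ 2
  have hbig : ∀ i, 2 ≤ ((U i).card : ℝ) * θ := by
    intro i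
    have hfac : q' / 8 * θ ≤ ((U i).card : ℝ) * θ :=
      mul_le_mul_of_nonneg_right (by linarith [hUcard i]) hθpos.le
    have hval : q' / 8 * θ = (80 * r) ^ 2 / 8 := by rw [hθ, hlog]; field_simp
    have h800 : (2 : ℝ) ≤ (80 * r) ^ 2 / 8 := by nlinarith [hrR]
    linarith
  -- FRAC applied to the planted configuration: `T = ∅`, `cap = r + 1`, `q = 2·4^{r+1} q'`
  have key := hn₀ (2 ^ (80 * r)) hn₀n G S hS hSR hBD W ∅ r (r + 1) (2 * 4 ^ (r + 1) * q') q' θ hWS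
    (Finset.empty_subset _) (Finset.disjoint_empty_right _) (by simp) (by simp) (by rw [hlog])
    (by rw [hlog]; push_cast; linarith) (by rw [min_eq_left (by norm_num)]; push_cast; linarith)
    le_rfl
    (by
      rw [show (1 / 4 : ℝ) ^ (r + 1) * (2 * 4 ^ (r + 1) * q') / 2 = ((1 / 4 : ℝ) * 4) ^ (r + 1) * q' by
        rw [mul_pow]; ring]
      norm_num)
    hθpos (by rw [hθ, div_mul_cancel₀ _ hq'pos.ne']) hrich
  -- every transversal of the groups `U i` is an inclusion-minimal trap
  refine false_of_transversal_traps U key hθpos hθlt hr1 hUU hbig ?_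
  intro f hf
  have hfinj : Function.Injective f := by
    intro i j hij
    by_contra hne
    exact Finset.disjoint_left.1 (hUU i j hne) (hf i) (hij ▸ hf j)
  have hBS : Finset.univ.image f ⊆ S := by
    intro x hx
    obtain ⟨i, -, rfl⟩ := Finset.mem_image.1 hx
    exact hUS i (hf i)
  have hBcard : (Finset.univ.image f).card = r + 1 := by
    rw [Finset.card_image_of_injective _ hfinj, Finset.card_univ, Fintype.card_fin]
  refine Finset.mem_filter.2 ⟨Finset.mem_powerset.2 hBS, hBcard.le, Finset.disjoint_empty_left _,
    ?_, ?_, ?_⟩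
  · -- `B` avoids `W`
    refine Finset.disjoint_left.2 fun v hvW hvB => ?_
    obtain ⟨i, -, rfl⟩ := Finset.mem_image.1 hvB
    exact Finset.disjoint_left.1 (hUW i) (hf i) hvW
  · -- `B` is a trap: no common neighbour in `W` (every `w ∈ C i` misses `f i`)
    have h0 : (W.filter fun v => ∀ u ∈ ∅ ∪ Finset.univ.image f, G.Adj u v) = ∅ := by
      refine Finset.filter_eq_empty_iff.2 fun v hv hall => ?_
      obtain ⟨i, hi⟩ := hcov v hv
      have hfi : f i ∈ ∅ ∪ Finset.univ.image f :=
        Finset.mem_union_right _ (Finset.mem_image_of_mem f (Finset.mem_univ i))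
      exact hhole i (f i) (hf i) v hi (hall (f i) hfi)
    rw [h0, Finset.card_empty, Nat.cast_zero]
    exact hq'pos
  · -- `B` is minimal: dropping `f i` frees the class `C i`
    intro B' hB'
    rw [Finset.mem_ssubsets] at hB'
    obtain ⟨x, hxB, hxB'⟩ := Finset.exists_of_ssubset hB'
    obtain ⟨i, -, rfl⟩ := Finset.mem_image.1 hxB
    have hB'R : B' ⊆ (Finset.univ.image f).erase (f i) := fun y hy =>
      Finset.mem_erase.2 ⟨fun h => hxB' (h ▸ hy), hB'.1 hy⟩
    have hRS : (Finset.univ.image f).erase (f i) ⊆ S := (Finset.erase_subset _ _).trans hBS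
    have hRcard : ((Finset.univ.image f).erase (f i)).card ≤ r := by
      rw [Finset.card_erase_of_mem hxB, hBcard]; omega
    have hRU : Disjoint ((Finset.univ.image f).erase (f i)) (U i) := by
      refine Finset.disjoint_left.2 fun y hyR hyU => ?_
      obtain ⟨hyne, hyB⟩ := Finset.mem_erase.1 hyR
      obtain ⟨j, -, rfl⟩ := Finset.mem_image.1 hyB
      by_cases hji : j = i
      · exact hyne (by rw [hji])
      · exact Finset.disjoint_left.1 (hUU j i hji) (hf j) hyU
    calc q' ≤ (((C i).filter fun v => ∀ u ∈ (Finset.univ.image f).erase (f i), G.Adj u v).card : ℝ) :=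
          hrich1 i _ hRS hRcard hRU
      _ ≤ ((W.filter fun v => ∀ u ∈ ∅ ∪ B', G.Adj u v).card : ℝ) := by
          exact_mod_cast Finset.card_le_card fun v hv => by
            rw [Finset.mem_filter] at hv ⊢
            exact ⟨hCW i hv.1, fun u hu => hv.2 u (hB'R (by simpa using hu))⟩

end Summit.PneNP.PneNP.Theorems.RegularResolutionRung.Negative
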